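import Literature.Geometry.Lorentzian.CoordWeightedHessianBoundary
import HarnessLib

/-!
# The pointwise Korn identity `|∇Y|² = 2|S(Y)|² − (div Y)² + Ric(Y,Y) + div((div Y)Y − ∇_Y Y)`

Topic `Literature/Geometry/Lorentzian`, coordinate tensor calculus `MetricCoord` (metric components
`G` on an open set `V`). Everything here is PROVED; no definition and no statement of `Prop` type
is introduced.

With `Q(A) = tr_G G(A·, A·)` (`mtrAt G x ((G x).bilinearComp A A)`, the Hilbert–Schmidt square
norm of an endomorphism) and `S(Y) = sym G(∇Y·, ·)` the Killing (deformation) form of a vector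
field:

* `IsMetricOn.normSqAt_metric_comp` — `|G(A·,·)|²_G = Q(A)`;
* `IsMetricOn.two_mul_normSqAt_symAt` — `2|sym G(A·,·)|² = Q(A) + tr(A²)`;
* **`IsMetricOn.korn_pointwise`** — for a smooth vector field `Y`,
  `|∇Y|² = 2|S(Y)|² − (div Y)² + Ric(Y,Y) + div((div Y) Y − ∇_Y Y)`
  (from the Bochner–Yano identity `div(∇_Y Y) − ∂_Y div Y = Ric(Y,Y) + tr((∇Y)²)`,
  `IsMetricOn.divAt_covDAt_self_sub`). Integrated over a compactly supported `Y` this is the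
  Korn-type identity `∫|∇Y|² = 2∫|S(Y)|² − ∫(div Y)² + ∫Ric(Y,Y)` used to pass from `S(Y)` to
  `∇Y` in the coercivity estimates of Chruściel–Delay 2003 (§3, (2.14), Prop. 3.1).

## References

* P. Petersen, *Riemannian Geometry*, 3rd ed., 2016, §9.2 (Bochner technique). [Petersen2016]
* P. T. Chruściel, E. Delay, Mém. Soc. Math. Fr. 94 (2003), §2–§3. [ChruscielDelay2003]
* B. O'Neill, *Semi-Riemannian geometry*, 1983, Ch. 2, Lemma 2.25; Ch. 3, Prop. 3.37.
  [ONeill1983]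
-/

noncomputable section

set_option maxSynthPendingDepth 3

open Set Filter Module Function
open scoped Topology ContDiff

namespace Literature.Geometry.Lorentzian

namespace MetricCoord

variable {E : Type*} [NormedAddCommGroup E] [NormedSpace ℝ E] [FiniteDimensional ℝ E]
  [CompleteSpace E] {G : E → E →L[ℝ] E →L[ℝ] ℝ} {V : Set E} {x : E} {Y : E → E}

/-! ### Frame identities -/

omit [CompleteSpace E] in
/-- **`|G(A·,·)|²_G = Q(A)`** at a symmetric positive definite point (both are `Σ_{ij} G(Ae_i,e_j)²`
in an orthonormal frame). [cite: ONeill1983, Ch. 2, Lemma 2.25] -/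
theorem IsMetricOn.normSqAt_metric_comp (hG : IsMetricOn G V) (hx : x ∈ V)
    (hpos : ∀ e : E, e ≠ 0 → 0 < G x e e) (A : E →L[ℝ] E) :
    normSqAt G x ((G x).comp A) = mtrAt G x ((G x).bilinearComp A A) := by
  have hi := hG.isInvertible x hx
  have hs := hG.symm x hx
  obtain ⟨e, he⟩ := exists_orthonormal_basis hs hpos
  rw [normSqAt_eq_sum_frame e he hi hs, mtrAt_eq_sum_frame e he hi]
  refine Finset.sum_congr rfl fun i _ ↦ ?_
  rw [ContinuousLinearMap.bilinearComp_apply, bilin_apply_eq_sum_frame e he (G x) (A (e i)) (A (e i))]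
  refine Finset.sum_congr rfl fun j _ ↦ ?_
  rw [ContinuousLinearMap.comp_apply, hs (e j) (A (e i)), sq]

omit [CompleteSpace E] in
/-- **`2|sym G(A·,·)|² = Q(A) + tr(A²)`** at a symmetric positive definite point.
[cite: ONeill1983, Ch. 2, Lemma 2.25] -/
theorem IsMetricOn.two_mul_normSqAt_symAt (hG : IsMetricOn G V) (hx : x ∈ V)
    (hpos : ∀ e : E, e ≠ 0 → 0 < G x e e) (A : E →L[ℝ] E) :
    2 * normSqAt G x (symAt ((G x).comp A)) =
      mtrAt G x ((G x).bilinearComp A A) + traceCLM E (A.comp A) := by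
  have hi := hG.isInvertible x hx
  have hs := hG.symm x hx
  obtain ⟨e, he⟩ := exists_orthonormal_basis hs hpos
  rw [← hG.normSqAt_metric_comp hx hpos A, normSqAt_eq_sum_frame e he hi hs,
    normSqAt_eq_sum_frame e he hi hs, traceCLM_eq_sum_of_orthonormal e he (A.comp A)]
  -- `tr(A²) = Σ_{ij} G(Ae_i,e_j) G(Ae_j,e_i)`
  have htr : ∀ i, G x (A (A (e i))) (e i) = ∑ j, G x (A (e i)) (e j) * G x (A (e j)) (e i) := by
    intro i
    have hexp : A (A (e i)) = ∑ j, G x (A (e i)) (e j) • A (e j) := by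
      conv_lhs => rw [← sum_apply_smul_of_orthonormal e he (A (e i))]
      rw [map_sum]
      exact Finset.sum_congr rfl fun j _ ↦ by rw [map_smul]
    rw [hexp, map_sum, _root_.sum_apply]
    exact Finset.sum_congr rfl fun j _ ↦ by rw [map_smul, _root_.smul_apply, smul_eq_mul]
  simp only [symAt_apply, ContinuousLinearMap.comp_apply]
  -- symmetrise the square sum
  have hsw : ∑ i, ∑ j, G x (A (e j)) (e i) ^ 2 = ∑ i, ∑ j, G x (A (e i)) (e j) ^ 2 :=
    Finset.sum_comm
  have hsplit : ∑ i, ∑ j, (2⁻¹ * (G x (A (e i)) (e j) + G x (A (e j)) (e i))) ^ 2 =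
      ∑ i, ∑ j, (4⁻¹ * G x (A (e i)) (e j) ^ 2 + 2⁻¹ * (G x (A (e i)) (e j) * G x (A (e j)) (e i))
        + 4⁻¹ * G x (A (e j)) (e i) ^ 2) :=
    Finset.sum_congr rfl fun i _ ↦ Finset.sum_congr rfl fun j _ ↦ by ring
  rw [hsplit]
  simp only [Finset.sum_add_distrib, ← Finset.mul_sum]
  rw [hsw]
  have htr' : ∑ i, G x (A (A (e i))) (e i) = ∑ i, ∑ j, G x (A (e i)) (e j) * G x (A (e j)) (e i) :=
    Finset.sum_congr rfl fun i _ ↦ htr i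
  rw [htr']
  ring

/-! ### The Korn identity -/

omit [CompleteSpace E] in
/-- `div (W − U) = div W − div U`. [folklore] -/
private theorem divAt_sub_korn {W U : E → E} (hW : DifferentiableAt ℝ W x)
    (hU : DifferentiableAt ℝ U x) :
    divAt G (fun y ↦ W y - U y) x = divAt G W x - divAt G U x := by
  rw [divAt_eq, divAt_eq, divAt_eq, covDAt_sub hW hU, map_sub]

/-- **The pointwise Korn identity**: for metric components `G` on `V` (positive definite at `x`)
and a smooth vector field `Y`,
`|∇Y|²_G = 2|S(Y)|²_G − (div Y)² + Ric(Y,Y) + div((div Y) Y − ∇_Y Y)` at `x`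
(`|∇Y|² = Q(∇Y)`, `S(Y) = sym G(∇Y·,·)`; Bochner–Yano: `div(∇_Y Y) − ∂_Y(div Y) = Ric(Y,Y) + tr((∇Y)²)`,
and `div((div Y)Y) = (div Y)² + ∂_Y(div Y)`). [cite: Petersen2016, §9.2] -/
theorem IsMetricOn.korn_pointwise (hG : IsMetricOn G V) (hx : x ∈ V)
    (hpos : ∀ e : E, e ≠ 0 → 0 < G x e e) (hY : ContDiffOn ℝ ∞ Y V) :
    mtrAt G x ((G x).bilinearComp (covDAt G Y x) (covDAt G Y x)) =
      2 * normSqAt G x (symAt ((G x).comp (covDAt G Y x))) - divAt G Y x ^ 2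
        + ricAt G x (Y x) (Y x)
        + divAt G (fun y ↦ (divAt G Y y) • Y y - covDAt G Y y (Y y)) x := by
  have hxs : V ∈ 𝓝 x := hG.mem_nhds hx
  have hYd : DifferentiableAt ℝ Y x := ((hY x hx).contDiffAt hxs).differentiableAt (by simp)
  have hdivd : DifferentiableAt ℝ (divAt G Y) x := (hG.hasFDerivAt_divAt hx hY).differentiableAt
  have hcovd : DifferentiableAt ℝ (fun y ↦ covDAt G Y y (Y y)) x :=
    (hG.hasFDerivAt_covDAt_self hx hY).differentiableAt
  have hYano := hG.divAt_covDAt_self_sub hx hY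
  have h1 : divAt G (fun y ↦ (divAt G Y y) • Y y - covDAt G Y y (Y y)) x =
      divAt G Y x * divAt G Y x + fderiv ℝ (divAt G Y) x (Y x)
        - divAt G (fun y ↦ covDAt G Y y (Y y)) x := by
    have hsub := divAt_sub_korn (G := G) (W := fun y ↦ (divAt G Y y) • Y y)
      (U := fun y ↦ covDAt G Y y (Y y)) (hdivd.smul hYd) hcovd
    have hsm : divAt G (fun y ↦ (divAt G Y y) • Y y) x =
        divAt G Y x * divAt G Y x + fderiv ℝ (divAt G Y) x (Y x) := divAt_smul hdivd hYd
    rw [hsub, hsm]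
  rw [hG.two_mul_normSqAt_symAt hx hpos, h1]
  linear_combination hYano

end MetricCoord

end Literature.Geometry.Lorentzian

end
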